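import Literature.IUT.HodgeArakelov.AbsTopMonoidsGenuineIsometries
import Literature.IUT.HodgeArakelov.AbsTopMonoidsGenuineOfSettingCapstone
import HarnessLib

/-!
# The ALL-FIELDS-GENUINE `AbsTopMonoids` producer (`genuineOfModelIsm`, `Ism(G)` = print's isometry group) AT THE GENUINE
# [IUTchII] §1 setting of the Tate curve — upgrade of the capstone (RQ7 note abc-iut-L6-t21 09:18Z)

S. Mochizuki, *Inter-universal Teichmüller theory II*, §1, Example 1.8 (ii)–(iv) (kurims pp. 35–39)
[claim: Mochizuki2012, status: disputed].  abc-iut-w5-d233's capstone (`AbsTopMonoidsGenuineOfSettingCapstone.lean`, p433775)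
instantiates abc-iut-L6-t13's `genuineOfModel`, whose `Ism` side is DEGENERATE; abc-iut-L6-d2's `genuineOfModelIsm`
(`AbsTopMonoidsGenuineIsometries.lean`, p427597) replaces that side by print's isometry group `Ism(G)` with `Ẑ^× ↠ ℤ_p^× ↪ Ism(G)`.
THIS FILE (post-freeze data, reading (ii): four producers + bookkeeping) instantiates THAT producer at the genuine setting
`ThetaSetting.ofDoubleUnderline C μ hC hS hl hp2 hpl hζ hη` with the setting's OWN MLF closure data (`TemperedCurve.mlfClosure` /
`mlfClosurePadic`) and Galois identifications (`galoisEpsilon` / `galoisEpsilonPadic`), given (H1) `hΔ` and (H2) `hq`, resp. from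
«`Π^tp_X → G_K` open» + ONE [AbsTopI] Thm 2.6 (v) regime package (abc-iut-w5-d233 p429527):
`genuineOfDoubleUnderlineIsm`, `genuineOfDoubleUnderlineIsmPadic`, `…_of_package`, with `…_Otri` / `…_Ism` (`rfl`).

HONEST SCOPE: instantiation only; residual named inputs exactly as in the capstone («aug open», F-0001 + `Δ` tfg on a completion
package); no curve / theta setting asserted to exist; nothing here bears on [IUTchIII] Cor. 3.12; no side is taken.
-/

noncomputable section

namespace Literature.IUT.HodgeArakelov

open Literature.AnabelianGeometry.AbsoluteAnabelian
open Literature.AnabelianGeometry.EtaleTheta Literature.AnabelianGeometry.SemiGraphs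
open scoped Literature.AnabelianGeometry.EtaleTheta

namespace AbsTopMonoids

variable {p : ℕ} [Fact p.Prime] {D : Literature.AnabelianGeometry.EtaleTheta.ThetaSetting p}
  {ED : D.EtaleThetaData} {l : ℕ} (C : ED.DoubleUnderline l) {N : ℕ+} (μ : D.CyclotomeMod l N)
  (hC : D.Compat) (hS : D.Sec2Hyps) (hl : l.Prime) (hp2 : p ≠ 2) (hpl : p ≠ l)
  (hζ : ∃ ζ : D.K, IsPrimitiveRoot ζ (4 * l)) {η : (C.thetaEnvData μ hC hS).PiYdd → MuN p N}
  (hη : η ∈ (C.thetaEnvData μ hC hS).thetaCocycles)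

/-- **The all-fields-genuine producer at the genuine setting over `(K, AlgebraicClosure K)`** (L6-d2's `genuineOfModelIsm`
with `TemperedCurve.mlfClosure` / `galoisEpsilon`), given (H1) and (H2).
[claim: Mochizuki2012, status: disputed] (IUTchII §1 Ex 1.8 (iv), kurims p.39) -/
def genuineOfDoubleUnderlineIsm
    (hΔ : ∀ f : (ThetaSetting.ofDoubleUnderline C μ hC hS hl hp2 hpl hζ hη).PiX ≃ₜ*
        (ThetaSetting.ofDoubleUnderline C μ hC hS hl hp2 hpl hζ hη).PiX,
      (ThetaSetting.ofDoubleUnderline C μ hC hS hl hp2 hpl hζ hη).DeltaX.map f.toMulEquiv.toMonoidHom =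
        (ThetaSetting.ofDoubleUnderline C μ hC hS hl hp2 hpl hζ hη).DeltaX)
    (hq : Nonempty (TopGroup.quot (ThetaSetting.ofDoubleUnderline C μ hC hS hl hp2 hpl hζ hη).PiX
        (ThetaSetting.ofDoubleUnderline C μ hC hS hl hp2 hpl hζ hη).DeltaX ≃ₜ*
        (ThetaSetting.ofDoubleUnderline C μ hC hS hl hp2 hpl hζ hη).Gk)) :
    AbsTopMonoids (ThetaSetting.ofDoubleUnderline C μ hC hS hl hp2 hpl hζ hη) :=
  genuineOfModelIsm (ThetaSetting.ofDoubleUnderline C μ hC hS hl hp2 hpl hζ hη) D.toTemperedCurve.mlfClosure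
    D.toTemperedCurve.galoisEpsilon hΔ hq

/-- **The all-fields-genuine producer at the genuine setting over `(K, ℚ̄_p, ε = id)`.**
[claim: Mochizuki2012, status: disputed] (IUTchII §1 Ex 1.8 (iv), kurims p.39) -/
def genuineOfDoubleUnderlineIsmPadic
    (hΔ : ∀ f : (ThetaSetting.ofDoubleUnderline C μ hC hS hl hp2 hpl hζ hη).PiX ≃ₜ*
        (ThetaSetting.ofDoubleUnderline C μ hC hS hl hp2 hpl hζ hη).PiX,
      (ThetaSetting.ofDoubleUnderline C μ hC hS hl hp2 hpl hζ hη).DeltaX.map f.toMulEquiv.toMonoidHom =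
        (ThetaSetting.ofDoubleUnderline C μ hC hS hl hp2 hpl hζ hη).DeltaX)
    (hq : Nonempty (TopGroup.quot (ThetaSetting.ofDoubleUnderline C μ hC hS hl hp2 hpl hζ hη).PiX
        (ThetaSetting.ofDoubleUnderline C μ hC hS hl hp2 hpl hζ hη).DeltaX ≃ₜ*
        (ThetaSetting.ofDoubleUnderline C μ hC hS hl hp2 hpl hζ hη).Gk)) :
    AbsTopMonoids (ThetaSetting.ofDoubleUnderline C μ hC hS hl hp2 hpl hζ hη) :=
  genuineOfModelIsm (ThetaSetting.ofDoubleUnderline C μ hC hS hl hp2 hpl hζ hη) D.toTemperedCurve.mlfClosurePadic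
    D.toTemperedCurve.galoisEpsilonPadic hΔ hq

/-- Its monoid at every isomorph IS `𝒪^⊳_{K̄_K}`. [claim: Mochizuki2012, status: disputed] (IUTchII §1 Ex 1.8 (ii), kurims p.36) -/
theorem genuineOfDoubleUnderlineIsm_Otri
    (hΔ : ∀ f : (ThetaSetting.ofDoubleUnderline C μ hC hS hl hp2 hpl hζ hη).PiX ≃ₜ*
        (ThetaSetting.ofDoubleUnderline C μ hC hS hl hp2 hpl hζ hη).PiX,
      (ThetaSetting.ofDoubleUnderline C μ hC hS hl hp2 hpl hζ hη).DeltaX.map f.toMulEquiv.toMonoidHom =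
        (ThetaSetting.ofDoubleUnderline C μ hC hS hl hp2 hpl hζ hη).DeltaX)
    (hq : Nonempty (TopGroup.quot (ThetaSetting.ofDoubleUnderline C μ hC hS hl hp2 hpl hζ hη).PiX
        (ThetaSetting.ofDoubleUnderline C μ hC hS hl hp2 hpl hζ hη).DeltaX ≃ₜ*
        (ThetaSetting.ofDoubleUnderline C μ hC hS hl hp2 hpl hζ hη).Gk))
    (G : IsoClass (ThetaSetting.ofDoubleUnderline C μ hC hS hl hp2 hpl hζ hη).Gk) :
    (genuineOfDoubleUnderlineIsm C μ hC hS hl hp2 hpl hζ hη hΔ hq).Otri G =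
      (ModelMLFGaloisData.galois D.toTemperedCurve.mlfClosure.k D.toTemperedCurve.mlfClosure.K).tmPair.M := rfl

/-- **`Ism(G)` of the genuine-setting producer IS print's isometry group** of `G ↷ O^{×μ}(G)` w.r.t. the open subgroups
(L6-d2's `genuineOfModelIsm_Ism`). [claim: Mochizuki2012, status: disputed] (IUTchII §1 Ex 1.8 (iv), kurims p.39) -/
theorem genuineOfDoubleUnderlineIsm_Ism
    (hΔ : ∀ f : (ThetaSetting.ofDoubleUnderline C μ hC hS hl hp2 hpl hζ hη).PiX ≃ₜ*
        (ThetaSetting.ofDoubleUnderline C μ hC hS hl hp2 hpl hζ hη).PiX,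
      (ThetaSetting.ofDoubleUnderline C μ hC hS hl hp2 hpl hζ hη).DeltaX.map f.toMulEquiv.toMonoidHom =
        (ThetaSetting.ofDoubleUnderline C μ hC hS hl hp2 hpl hζ hη).DeltaX)
    (hq : Nonempty (TopGroup.quot (ThetaSetting.ofDoubleUnderline C μ hC hS hl hp2 hpl hζ hη).PiX
        (ThetaSetting.ofDoubleUnderline C μ hC hS hl hp2 hpl hζ hη).DeltaX ≃ₜ*
        (ThetaSetting.ofDoubleUnderline C μ hC hS hl hp2 hpl hζ hη).Gk))
    (G : IsoClass (ThetaSetting.ofDoubleUnderline C μ hC hS hl hp2 hpl hζ hη).Gk) :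
    (genuineOfDoubleUnderlineIsm C μ hC hS hl hp2 hpl hζ hη hΔ hq).Ism G =
      ↥((genuineOfModel (ThetaSetting.ofDoubleUnderline C μ hC hS hl hp2 hpl hζ hη) D.toTemperedCurve.mlfClosure
          D.toTemperedCurve.galoisEpsilon hΔ hq).ism G) := rfl

/-- **The all-fields-genuine producer at the genuine setting from «aug open» + ONE regime package** (over `(K, AlgebraicClosure K)`).
[claim: Mochizuki2012, status: disputed] (IUTchII §1 Ex 1.8 (iv), kurims p.39) -/
def genuineOfDoubleUnderlineIsm_of_package
    (hopen : IsOpenMap fun x : D.PiTemp => (⟨D.aug x, D.aug_mem_GK x⟩ : D.GK))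
    (h : ∃ (E : FundamentalExtension.{0}) (_ : E.MLFBase)
      (ι : (ThetaSetting.ofDoubleUnderline C μ hC hS hl hp2 hpl hζ hη).PiX →ₜ* E.arith)
      (g : (ThetaSetting.ofDoubleUnderline C μ hC hS hl hp2 hpl hζ hη).Gk →* E.gal),
      IsProfiniteCompletion ι ∧ Function.Injective g ∧
        (∀ x, E.aug (ι x) = g ((ThetaSetting.ofDoubleUnderline C μ hC hS hl hp2 hpl hζ hη).aug x)) ∧
        IsTopologicallyFinitelyGenerated E.geom ∧ E.CoinvariantRankConstant) :
    AbsTopMonoids (ThetaSetting.ofDoubleUnderline C μ hC hS hl hp2 hpl hζ hη) :=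
  genuineOfDoubleUnderlineIsm C μ hC hS hl hp2 hpl hζ hη
    (ThetaSetting.deltaX_characteristic_ofDoubleUnderline_of_exists_package C μ hC hS hl hp2 hpl hζ hη h)
    (quotDeltaX_iso_of_isOpenMap _ (hopen.comp C.isOpen_Huu.isOpenMap_subtype_val))

/-- **The all-fields-genuine producer at the genuine setting from «aug open» + ONE regime package** (over `(K, ℚ̄_p, ε = id)`).
[claim: Mochizuki2012, status: disputed] (IUTchII §1 Ex 1.8 (iv), kurims p.39) -/
def genuineOfDoubleUnderlineIsmPadic_of_package
    (hopen : IsOpenMap fun x : D.PiTemp => (⟨D.aug x, D.aug_mem_GK x⟩ : D.GK))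
    (h : ∃ (E : FundamentalExtension.{0}) (_ : E.MLFBase)
      (ι : (ThetaSetting.ofDoubleUnderline C μ hC hS hl hp2 hpl hζ hη).PiX →ₜ* E.arith)
      (g : (ThetaSetting.ofDoubleUnderline C μ hC hS hl hp2 hpl hζ hη).Gk →* E.gal),
      IsProfiniteCompletion ι ∧ Function.Injective g ∧
        (∀ x, E.aug (ι x) = g ((ThetaSetting.ofDoubleUnderline C μ hC hS hl hp2 hpl hζ hη).aug x)) ∧
        IsTopologicallyFinitelyGenerated E.geom ∧ E.CoinvariantRankConstant) :
    AbsTopMonoids (ThetaSetting.ofDoubleUnderline C μ hC hS hl hp2 hpl hζ hη) :=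
  genuineOfDoubleUnderlineIsmPadic C μ hC hS hl hp2 hpl hζ hη
    (ThetaSetting.deltaX_characteristic_ofDoubleUnderline_of_exists_package C μ hC hS hl hp2 hpl hζ hη h)
    (quotDeltaX_iso_of_isOpenMap _ (hopen.comp C.isOpen_Huu.isOpenMap_subtype_val))

/-- **∃-form, all fields genuine**: under «aug open» + ONE regime package the interface `AbsTopMonoids` of [IUTchII] Ex 1.8 is
inhabited at the genuine setting by a producer with monoid `𝒪^⊳_{K̄_K}` AND `Ism(G)` = print's isometry group.
[claim: Mochizuki2012, status: disputed] (IUTchII §1 Ex 1.8 (iv), kurims p.39) -/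
theorem exists_genuineIsm_ofDoubleUnderline_of_package
    (hopen : IsOpenMap fun x : D.PiTemp => (⟨D.aug x, D.aug_mem_GK x⟩ : D.GK))
    (h : ∃ (E : FundamentalExtension.{0}) (_ : E.MLFBase)
      (ι : (ThetaSetting.ofDoubleUnderline C μ hC hS hl hp2 hpl hζ hη).PiX →ₜ* E.arith)
      (g : (ThetaSetting.ofDoubleUnderline C μ hC hS hl hp2 hpl hζ hη).Gk →* E.gal),
      IsProfiniteCompletion ι ∧ Function.Injective g ∧
        (∀ x, E.aug (ι x) = g ((ThetaSetting.ofDoubleUnderline C μ hC hS hl hp2 hpl hζ hη).aug x)) ∧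
        IsTopologicallyFinitelyGenerated E.geom ∧ E.CoinvariantRankConstant) :
    ∃ A : AbsTopMonoids (ThetaSetting.ofDoubleUnderline C μ hC hS hl hp2 hpl hζ hη),
      (∀ G, A.Otri G =
        (ModelMLFGaloisData.galois D.toTemperedCurve.mlfClosure.k D.toTemperedCurve.mlfClosure.K).tmPair.M) ∧
      ∀ G, A.Ism G = ↥((genuineOfModel (ThetaSetting.ofDoubleUnderline C μ hC hS hl hp2 hpl hζ hη)
          D.toTemperedCurve.mlfClosure D.toTemperedCurve.galoisEpsilon
          (ThetaSetting.deltaX_characteristic_ofDoubleUnderline_of_exists_package C μ hC hS hl hp2 hpl hζ hη h)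
          (quotDeltaX_iso_of_isOpenMap _ (hopen.comp C.isOpen_Huu.isOpenMap_subtype_val))).ism G) :=
  ⟨genuineOfDoubleUnderlineIsm_of_package C μ hC hS hl hp2 hpl hζ hη hopen h, fun _ => rfl, fun _ => rfl⟩

end AbsTopMonoids

end Literature.IUT.HodgeArakelov

end
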